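import Literature.Analysis.FunctionSpaces.TorusFluidGlueProofs
import Literature.Analysis.FunctionSpaces.TorusTrilinearH1
import Literature.Analysis.FunctionSpaces.TorusClassicalNSUniqueness
import Literature.Analysis.FunctionSpaces.TorusLerayHelmholtz
import Literature.Analysis.FunctionSpaces.TorusTestFunction
import Literature.Analysis.FunctionSpaces.TorusFourierConvolution
import Literature.Analysis.FunctionSpaces.TorusConvectionLaplacianNormSq
import Literature.Analysis.FunctionSpaces.TorusCalculusProofs
import Summits.AnomalousDissipation.AnomalousDissipation.Theorems.NonresonantSelection.Negative.TranslationMode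
import HarnessLib

/-!
# Stub `stub_kellerAnalysis` of the line `birth`
# (crux stmt-AnomalousDissipation-16294, `NeutralTaylorWaves.NonresonantSelection`)

Keller's bordering lemma, analytic half, for the steady Navier–Stokes operator on `T³`
linearised at a smooth divergence-free base `w` with drift `c` along `x₃` and viscosity `ν`:
`A(v, r) := (w·∇)v + (v·∇)w − νΔv + ∇r − c∂₃v`.  For a test triple `(v, r, b)` put
`F := A(v, r) − b∂₃w` (the bordered residual), `φ := ∂₃w`, `Φ² := ∫ ‖φ‖² > 0`,
`s := ⟨v, φ⟩ / Φ²` and `u := v − sφ` (smooth, divergence-free, mean-zero and `⊥ φ`).  Then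

* (i) `‖v‖₂ ≤ ‖u‖₂ + |s| Φ` (Minkowski);
* (ii) if `‖u′‖₂ ≤ Λ ‖A(u′, r′)‖₂` for test fields `u′ ⊥ φ` (`Λ ≥ 0`) and `‖A(φ, q₃)‖₂ ≤ ρ`, then
  `‖u‖₂ ≤ Λ (‖F‖₂ + |b| Φ + |s| ρ)`, by the pointwise linearity
  `A(u, r − s q₃) = A(v, r) − s A(φ, q₃) = F + bφ − s A(φ, q₃)` and Minkowski;
* (iii) if `|⟨ψ, A(v′, r′)⟩| ≤ ρ′ ‖v′‖₂` on the test class and `‖ψ‖₂ ≤ 1`, then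
  `|b| · |⟨ψ, φ⟩| ≤ ‖F‖₂ + ρ′ ‖v‖₂` (`b⟨ψ, φ⟩ = ⟨ψ, A(v, r)⟩ − ⟨ψ, F⟩`, Cauchy–Schwarz).

Everything is elementary torus calculus (`Torus.fderiv_sub`, `Torus.fderiv_const_smul`,
`Torus.laplacian_sub`, `Torus.laplacian_const_smul_apply`, `Torus.gradient_sub`,
`Torus.partialDeriv_sub`, `Torus.partialDeriv_const_smul`, and `div ∂₃w = 0`,
`NonresonantSelection.Negative.isDivFree_partialDeriv` of `Theorems/…/Negative/TranslationMode`) and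
`L²(T³)` bookkeeping on the probability space `T³` (`Torus.sqrt_integral_norm_add_sq_le`,
`Torus.integral_mul_le_sqrt_mul_sqrt_of_continuous`).

No definitions; helper lemmas are prefixed `nonresonantSelection_keller_`.  The last theorem is the
registered stub signature verbatim.
-/

-- `Summit.<Summit>.<Problem>` is the tree's mandated summit-side namespace (CONVENTIONS §2); for this
-- single-conjunct summit the two coincide, so the duplicate is deliberate.
set_option linter.dupNamespace false

noncomputable section

namespace Summit.AnomalousDissipation.AnomalousDissipation.Theorems

open MeasureTheory
open scoped InnerProductSpace
open Literature.Analysis.FunctionSpaces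

/-! ## `L²(T³)` bookkeeping -/

/-- `‖t • g‖₂ = |t| ‖g‖₂` on `T³`. [folklore] -/
theorem nonresonantSelection_keller_sqrt_integral_smul {G : Type*} [NormedAddCommGroup G]
    [NormedSpace ℝ G] (g : UnitAddTorus (Fin 3) → G) (t : ℝ) :
    Real.sqrt (∫ x, ‖t • g x‖ ^ 2) = |t| * Real.sqrt (∫ x, ‖g x‖ ^ 2) := by
  have h : ∀ x, ‖t • g x‖ ^ 2 = |t| ^ 2 * ‖g x‖ ^ 2 := fun x => by
    rw [norm_smul, Real.norm_eq_abs, mul_pow]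
  simp_rw [h, integral_const_mul]
  rw [Real.sqrt_mul (sq_nonneg _), Real.sqrt_sq (abs_nonneg _)]

/-- Minkowski with a scalar: `‖f + t • g‖₂ ≤ ‖f‖₂ + |t| ‖g‖₂` for continuous fields on `T³`.
[folklore] -/
theorem nonresonantSelection_keller_sqrt_integral_add_smul_le {G : Type*} [NormedAddCommGroup G]
    [InnerProductSpace ℝ G] {f g : UnitAddTorus (Fin 3) → G} (hf : Continuous f)
    (hg : Continuous g) (t : ℝ) :
    Real.sqrt (∫ x, ‖f x + t • g x‖ ^ 2) ≤
      Real.sqrt (∫ x, ‖f x‖ ^ 2) + |t| * Real.sqrt (∫ x, ‖g x‖ ^ 2) := by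
  rw [← nonresonantSelection_keller_sqrt_integral_smul g t]
  exact Torus.sqrt_integral_norm_add_sq_le hf (hg.const_smul t)

/-- Minkowski with a scalar: `‖f − t • g‖₂ ≤ ‖f‖₂ + |t| ‖g‖₂` for continuous fields on `T³`.
[folklore] -/
theorem nonresonantSelection_keller_sqrt_integral_sub_smul_le {G : Type*} [NormedAddCommGroup G]
    [InnerProductSpace ℝ G] {f g : UnitAddTorus (Fin 3) → G} (hf : Continuous f)
    (hg : Continuous g) (t : ℝ) :
    Real.sqrt (∫ x, ‖f x - t • g x‖ ^ 2) ≤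
      Real.sqrt (∫ x, ‖f x‖ ^ 2) + |t| * Real.sqrt (∫ x, ‖g x‖ ^ 2) := by
  have h := nonresonantSelection_keller_sqrt_integral_add_smul_le hf hg (-t)
  simp_rw [neg_smul, ← sub_eq_add_neg, abs_neg] at h
  exact h

/-- Conclusion (i) of the bordering lemma: `‖v‖₂ ≤ ‖v − s φ‖₂ + |s| ‖φ‖₂`. [folklore] -/
theorem nonresonantSelection_keller_sqrt_integral_le_sub_add {G : Type*} [NormedAddCommGroup G]
    [InnerProductSpace ℝ G] {v φ : UnitAddTorus (Fin 3) → G} (hv : Continuous v)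
    (hφ : Continuous φ) (s : ℝ) :
    Real.sqrt (∫ x, ‖v x‖ ^ 2) ≤
      Real.sqrt (∫ x, ‖v x - s • φ x‖ ^ 2) + |s| * Real.sqrt (∫ x, ‖φ x‖ ^ 2) := by
  have h :=
    nonresonantSelection_keller_sqrt_integral_add_smul_le (hv.fun_sub (hφ.fun_const_smul s)) hφ s
  simp_rw [sub_add_cancel] at h
  exact h

/-- Cauchy–Schwarz: `|∫ ⟪F, G⟫| ≤ ‖F‖₂ ‖G‖₂` for continuous fields on `T³`. [folklore] -/
theorem nonresonantSelection_keller_abs_integral_inner_le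
    {F G : UnitAddTorus (Fin 3) → EuclideanSpace ℝ (Fin 3)} (hF : Continuous F)
    (hG : Continuous G) :
    |∫ x, ⟪F x, G x⟫_ℝ| ≤ Real.sqrt (∫ x, ‖F x‖ ^ 2) * Real.sqrt (∫ x, ‖G x‖ ^ 2) := by
  calc |∫ x, ⟪F x, G x⟫_ℝ| ≤ ∫ x, |⟪F x, G x⟫_ℝ| := abs_integral_le_integral_abs
    _ ≤ ∫ x, ‖F x‖ * ‖G x‖ :=
        integral_mono (hF.inner hG).abs.integrable_unitAddTorus
          (hF.norm.mul hG.norm).integrable_unitAddTorus fun x => abs_real_inner_le_norm _ _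
    _ ≤ Real.sqrt (∫ x, ‖F x‖ ^ 2) * Real.sqrt (∫ x, ‖G x‖ ^ 2) :=
        Torus.integral_mul_le_sqrt_mul_sqrt_of_continuous hF.norm hG.norm
          (fun _ => norm_nonneg _) fun _ => norm_nonneg _

/-! ## Torus calculus of the correction `u = v − s φ` -/

/-- `div (t • g) = t · div g` on the torus (no differentiability needed: `deriv_const_mul_field`).
[folklore] -/
theorem nonresonantSelection_keller_divergence_const_smul (t : ℝ)
    (g : UnitAddTorus (Fin 3) → EuclideanSpace ℝ (Fin 3)) (x : UnitAddTorus (Fin 3)) :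
    Torus.divergence (t • g) x = t * Torus.divergence g x := by
  -- adapted from Theorems/TwohalfdThesis/Negative/PlanarForceOfDescent `divergence_const_smul`
  unfold Torus.divergence Torus.partialDeriv Torus.lineDeriv
  rw [Finset.mul_sum]
  refine Finset.sum_congr rfl fun i _ => ?_
  simp only [Pi.smul_apply, PiLp.smul_apply, smul_eq_mul]
  exact deriv_const_mul_field t

/-- `v − s φ` is divergence free for smooth divergence-free `v`, `φ`. [folklore] -/
theorem nonresonantSelection_keller_isDivFree_sub_smul
    {v φ : UnitAddTorus (Fin 3) → EuclideanSpace ℝ (Fin 3)} (hv : Torus.IsSmooth v)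
    (hφ : Torus.IsSmooth φ) (hvdiv : Torus.IsDivFree v) (hφdiv : Torus.IsDivFree φ) (s : ℝ) :
    Torus.IsDivFree (fun x => v x - s • φ x) := by
  intro x
  show Torus.divergence (v - s • φ) x = 0
  rw [Torus.divergence_sub (hv.isContDiff (by simp)) ((hφ.smul s).isContDiff (by simp)),
    nonresonantSelection_keller_divergence_const_smul, hvdiv x, hφdiv x, mul_zero, sub_zero]

/-- `v − s φ` has zero mean for smooth mean-zero `v`, `φ`. [folklore] -/
theorem nonresonantSelection_keller_hasZeroMean_sub_smul
    {v φ : UnitAddTorus (Fin 3) → EuclideanSpace ℝ (Fin 3)} (hv : Torus.IsSmooth v)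
    (hφ : Torus.IsSmooth φ) (hvmean : Torus.HasZeroMean v) (hφmean : Torus.HasZeroMean φ)
    (s : ℝ) : Torus.HasZeroMean (fun x => v x - s • φ x) := by
  have i2 : Integrable (fun x => s • φ x) volume := (hφ.smul s).integrable
  have h1 : ∫ x, v x = 0 := hvmean
  have h2 : ∫ x, φ x = 0 := hφmean
  show ∫ x, (v x - s • φ x) = 0
  rw [integral_sub hv.integrable i2, integral_smul, h1, h2, smul_zero, sub_zero]

/-- With `s = ⟨v, φ⟩ / ‖φ‖₂²` (`‖φ‖₂ ≠ 0`), `v − s φ ⊥ φ` in `L²(T³)`. [folklore] -/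
theorem nonresonantSelection_keller_orthogonal
    {v φ : UnitAddTorus (Fin 3) → EuclideanSpace ℝ (Fin 3)} (hv : Torus.IsSmooth v)
    (hφ : Torus.IsSmooth φ) (hI : (∫ x, ‖φ x‖ ^ 2) ≠ 0) :
    (∫ x, ⟪v x - ((∫ y, ⟪v y, φ y⟫_ℝ) / (∫ y, ‖φ y‖ ^ 2)) • φ x, φ x⟫_ℝ) = 0 := by
  have i1 : Integrable (fun x => ⟪v x, φ x⟫_ℝ) volume := (hv.inner hφ).integrable
  have i2 : Integrable (fun x => ((∫ y, ⟪v y, φ y⟫_ℝ) / (∫ y, ‖φ y‖ ^ 2)) * ‖φ x‖ ^ 2) volume :=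
    hφ.norm_sq.integrable.const_mul _
  simp only [inner_sub_left, real_inner_smul_left, real_inner_self_eq_norm_sq]
  rw [integral_sub i1 i2, integral_const_mul, div_mul_cancel₀ _ hI, sub_self]

/-- **Pointwise linearity of the linearised operator**: with
`A(v, r) = (w·∇)v + (v·∇)w − νΔv + ∇r − c∂₃v`, for smooth data
`A(v − sφ, r − sq) = A(v, r) − s A(φ, q)` pointwise. [folklore] -/
theorem nonresonantSelection_keller_op_sub_smul {ν c s : ℝ}
    {w v φ : UnitAddTorus (Fin 3) → EuclideanSpace ℝ (Fin 3)} {r q : UnitAddTorus (Fin 3) → ℝ}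
    (hv : Torus.IsSmooth v) (hφ : Torus.IsSmooth φ) (hr : Torus.IsSmooth r)
    (hq : Torus.IsSmooth q) (x : UnitAddTorus (Fin 3)) :
    Torus.convect w (fun y => v y - s • φ y) x + Torus.convect (fun y => v y - s • φ y) w x -
        ν • Torus.laplacian (fun y => v y - s • φ y) x +
        Torus.gradient (fun y => r y - s * q y) x -
        c • Torus.partialDeriv (2 : Fin 3) (fun y => v y - s • φ y) x =
      (Torus.convect w v x + Torus.convect v w x - ν • Torus.laplacian v x + Torus.gradient r x -
          c • Torus.partialDeriv (2 : Fin 3) v x) -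
        s • (Torus.convect w φ x + Torus.convect φ w x - ν • Torus.laplacian φ x +
          Torus.gradient q x - c • Torus.partialDeriv (2 : Fin 3) φ x) := by
  have hv1 : Torus.IsContDiff 1 v := hv.isContDiff (by simp)
  have hφ1 : Torus.IsContDiff 1 φ := hφ.isContDiff (by simp)
  have hsφ1 : Torus.IsContDiff 1 (s • φ) := hφ1.smul s
  have hr1 : Torus.IsContDiff 1 r := hr.isContDiff (by simp)
  have hq1 : Torus.IsContDiff 1 q := hq.isContDiff (by simp)
  have h1 : Torus.convect w (fun y => v y - s • φ y) x =
      Torus.convect w v x - s • Torus.convect w φ x := by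
    show Torus.fderiv (v - s • φ) x (w x) = Torus.fderiv v x (w x) - s • Torus.fderiv φ x (w x)
    rw [Torus.fderiv_sub hv1 hsφ1, Torus.fderiv_const_smul hφ1, sub_apply, smul_apply]
  have h2 : Torus.convect (fun y => v y - s • φ y) w x =
      Torus.convect v w x - s • Torus.convect φ w x := by
    simp only [Torus.convect, map_sub, map_smul]
  have h3 : Torus.laplacian (fun y => v y - s • φ y) x =
      Torus.laplacian v x - s • Torus.laplacian φ x := by
    show Torus.laplacian (v - s • φ) x = _
    rw [Torus.laplacian_sub hv (hφ.smul s), Pi.sub_apply, Torus.laplacian_const_smul_apply hφ]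
  have h4 : Torus.gradient (fun y => r y - s * q y) x =
      Torus.gradient r x - s • Torus.gradient q x := by
    show Torus.gradient (r - s • q) x = _
    rw [Torus.gradient_sub hr1 (hq1.smul s)]
    congr 1
    refine ext_inner_right ℝ fun e => ?_
    rw [Torus.inner_gradient_left, Torus.fderiv_const_smul hq1, smul_apply, real_inner_smul_left,
      Torus.inner_gradient_left, smul_eq_mul]
  have h5 : Torus.partialDeriv (2 : Fin 3) (fun y => v y - s • φ y) x =
      Torus.partialDeriv (2 : Fin 3) v x - s • Torus.partialDeriv (2 : Fin 3) φ x := by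
    show Torus.partialDeriv (2 : Fin 3) (v - s • φ) x = _
    rw [Torus.partialDeriv_sub hv1 hsφ1, Pi.sub_apply, Torus.partialDeriv_const_smul hφ1,
      Pi.smul_apply]
  rw [h1, h2, h3, h4, h5]
  simp only [smul_sub, smul_add, smul_smul, mul_comm ν s, mul_comm c s]
  abel

/-! ## The three conclusions -/

/-- Conclusion (ii) of the bordering lemma (reduced bound for the correction `u = v − sφ`): if
`u ⊥ φ`, the reduced gap bound `‖u′‖₂ ≤ Λ ‖A(u′, r′)‖₂` on test fields `u′ ⊥ φ` and the kernel
bound `‖A(φ, q₃)‖₂ ≤ ρ` give `‖u‖₂ ≤ Λ (‖A(v, r) − bφ‖₂ + |b| ‖φ‖₂ + |s| ρ)`. [folklore] -/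
theorem nonresonantSelection_keller_reduced_bound {ν c b Λ ρ s : ℝ}
    {w φ v : UnitAddTorus (Fin 3) → EuclideanSpace ℝ (Fin 3)} {q₃ r : UnitAddTorus (Fin 3) → ℝ}
    (hΛ : 0 ≤ Λ) (hw : Torus.IsSmooth w) (hφ : Torus.IsSmooth φ) (hφdiv : Torus.IsDivFree φ)
    (hφmean : Torus.HasZeroMean φ) (hq : Torus.IsSmooth q₃) (hv : Torus.IsSmooth v)
    (hvdiv : Torus.IsDivFree v) (hvmean : Torus.HasZeroMean v) (hr : Torus.IsSmooth r)
    (horth : (∫ x, ⟪v x - s • φ x, φ x⟫_ℝ) = 0)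
    (hgap : ∀ (u : UnitAddTorus (Fin 3) → EuclideanSpace ℝ (Fin 3)) (r' : UnitAddTorus (Fin 3) → ℝ),
      Torus.IsSmooth u → Torus.IsSmooth r' → Torus.IsDivFree u → Torus.HasZeroMean u →
      (∫ x, ⟪u x, φ x⟫_ℝ) = 0 →
      Real.sqrt (∫ x, ‖u x‖ ^ 2) ≤
        Λ * Real.sqrt (∫ x, ‖Torus.convect w u x + Torus.convect u w x - ν • Torus.laplacian u x +
          Torus.gradient r' x - c • Torus.partialDeriv (2 : Fin 3) u x‖ ^ 2))
    (hker : Real.sqrt (∫ x, ‖Torus.convect w φ x + Torus.convect φ w x -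
        ν • Torus.laplacian φ x + Torus.gradient q₃ x -
        c • Torus.partialDeriv (2 : Fin 3) φ x‖ ^ 2) ≤ ρ) :
    Real.sqrt (∫ x, ‖v x - s • φ x‖ ^ 2) ≤
      Λ * (Real.sqrt (∫ x, ‖Torus.convect w v x + Torus.convect v w x - ν • Torus.laplacian v x +
          Torus.gradient r x - c • Torus.partialDeriv (2 : Fin 3) v x - b • φ x‖ ^ 2) +
        |b| * Real.sqrt (∫ x, ‖φ x‖ ^ 2) + |s| * ρ) := by
  -- the correction is an admissible test field
  have hu : Torus.IsSmooth (fun x => v x - s • φ x) := hv.sub (hφ.smul s)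
  have hr' : Torus.IsSmooth (fun x => r x - s * q₃ x) := hr.sub (hq.smul s)
  have h1 := hgap (fun x => v x - s • φ x) (fun x => r x - s * q₃ x) hu hr'
    (nonresonantSelection_keller_isDivFree_sub_smul hv hφ hvdiv hφdiv s)
    (nonresonantSelection_keller_hasZeroMean_sub_smul hv hφ hvmean hφmean s) horth
  -- linearity: `A(u, r − s q₃) = (A(v, r) − bφ) + bφ − s A(φ, q₃)`
  have key : ∀ x, Torus.convect w (fun y => v y - s • φ y) x +
        Torus.convect (fun y => v y - s • φ y) w x -
        ν • Torus.laplacian (fun y => v y - s • φ y) x +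
        Torus.gradient (fun y => r y - s * q₃ y) x -
        c • Torus.partialDeriv (2 : Fin 3) (fun y => v y - s • φ y) x =
      Torus.convect w v x + Torus.convect v w x - ν • Torus.laplacian v x +
          Torus.gradient r x - c • Torus.partialDeriv (2 : Fin 3) v x - b • φ x + b • φ x -
        s • (Torus.convect w φ x + Torus.convect φ w x - ν • Torus.laplacian φ x +
          Torus.gradient q₃ x - c • Torus.partialDeriv (2 : Fin 3) φ x) := fun x => by
    rw [sub_add_cancel]
    exact nonresonantSelection_keller_op_sub_smul hv hφ hr hq x
  simp only [key] at h1
  -- continuity of the three fields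
  have cF : Continuous fun x => Torus.convect w v x + Torus.convect v w x -
      ν • Torus.laplacian v x + Torus.gradient r x - c • Torus.partialDeriv (2 : Fin 3) v x -
      b • φ x :=
    ((((((hw.convect hv).add (hv.convect hw)).sub (hv.laplacian.smul ν)).add hr.gradient).sub
      ((hv.partialDeriv 2).smul c)).sub (hφ.smul b)).continuous
  have cA : Continuous fun x => Torus.convect w φ x + Torus.convect φ w x -
      ν • Torus.laplacian φ x + Torus.gradient q₃ x - c • Torus.partialDeriv (2 : Fin 3) φ x :=
    (((((hw.convect hφ).add (hφ.convect hw)).sub (hφ.laplacian.smul ν)).add hq.gradient).sub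
      ((hφ.partialDeriv 2).smul c)).continuous
  -- Minkowski
  have hM1 := nonresonantSelection_keller_sqrt_integral_sub_smul_le
    (cF.fun_add (hφ.continuous.fun_const_smul b)) cA s
  have hM2 := nonresonantSelection_keller_sqrt_integral_add_smul_le cF hφ.continuous b
  have hK : |s| * Real.sqrt (∫ x, ‖Torus.convect w φ x + Torus.convect φ w x -
      ν • Torus.laplacian φ x + Torus.gradient q₃ x -
      c • Torus.partialDeriv (2 : Fin 3) φ x‖ ^ 2) ≤ |s| * ρ :=
    mul_le_mul_of_nonneg_left hker (abs_nonneg s)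
  refine h1.trans (mul_le_mul_of_nonneg_left ?_ hΛ)
  linarith

/-- Conclusion (iii) of the bordering lemma (border bound): if `|⟨ψ, A(v, r)⟩| ≤ ρ′ ‖v‖₂` and
`‖ψ‖₂ ≤ 1`, then `|b| · |⟨ψ, φ⟩| ≤ ‖A(v, r) − bφ‖₂ + ρ′ ‖v‖₂`. [folklore] -/
theorem nonresonantSelection_keller_border_bound {ν c b ρ' : ℝ}
    {w ψ v φ : UnitAddTorus (Fin 3) → EuclideanSpace ℝ (Fin 3)} {r : UnitAddTorus (Fin 3) → ℝ}
    (hw : Torus.IsSmooth w) (hψ : Torus.IsSmooth ψ) (hv : Torus.IsSmooth v)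
    (hr : Torus.IsSmooth r) (hφ : Torus.IsSmooth φ) (hψ1 : (∫ x, ‖ψ x‖ ^ 2) ≤ 1)
    (hco : |∫ x, ⟪ψ x, Torus.convect w v x + Torus.convect v w x - ν • Torus.laplacian v x +
        Torus.gradient r x - c • Torus.partialDeriv (2 : Fin 3) v x⟫_ℝ| ≤
      ρ' * Real.sqrt (∫ x, ‖v x‖ ^ 2)) :
    |b| * |∫ x, ⟪ψ x, φ x⟫_ℝ| ≤
      Real.sqrt (∫ x, ‖Torus.convect w v x + Torus.convect v w x - ν • Torus.laplacian v x +
          Torus.gradient r x - c • Torus.partialDeriv (2 : Fin 3) v x - b • φ x‖ ^ 2) +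
        ρ' * Real.sqrt (∫ x, ‖v x‖ ^ 2) := by
  have hAs : Torus.IsSmooth fun x => Torus.convect w v x + Torus.convect v w x -
      ν • Torus.laplacian v x + Torus.gradient r x - c • Torus.partialDeriv (2 : Fin 3) v x :=
    ((((hw.convect hv).add (hv.convect hw)).sub (hv.laplacian.smul ν)).add hr.gradient).sub
      ((hv.partialDeriv 2).smul c)
  have hFs : Torus.IsSmooth fun x => Torus.convect w v x + Torus.convect v w x -
      ν • Torus.laplacian v x + Torus.gradient r x - c • Torus.partialDeriv (2 : Fin 3) v x -
      b • φ x := hAs.sub (hφ.smul b)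
  have iA : Integrable (fun x => ⟪ψ x, Torus.convect w v x + Torus.convect v w x -
      ν • Torus.laplacian v x + Torus.gradient r x - c • Torus.partialDeriv (2 : Fin 3) v x⟫_ℝ)
      volume := (hψ.inner hAs).integrable
  have iφ : Integrable (fun x => b * ⟪ψ x, φ x⟫_ℝ) volume := (hψ.inner hφ).integrable.const_mul b
  have hsplit : (∫ x, ⟪ψ x, Torus.convect w v x + Torus.convect v w x - ν • Torus.laplacian v x +
        Torus.gradient r x - c • Torus.partialDeriv (2 : Fin 3) v x - b • φ x⟫_ℝ) =
      (∫ x, ⟪ψ x, Torus.convect w v x + Torus.convect v w x - ν • Torus.laplacian v x +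
        Torus.gradient r x - c • Torus.partialDeriv (2 : Fin 3) v x⟫_ℝ) -
        b * ∫ x, ⟪ψ x, φ x⟫_ℝ := by
    rw [← integral_const_mul, ← integral_sub iA iφ]
    refine integral_congr_ae (ae_of_all _ fun x => ?_)
    simp only [inner_sub_right, real_inner_smul_right]
  have hCS := nonresonantSelection_keller_abs_integral_inner_le hψ.continuous hFs.continuous
  have hψle : Real.sqrt (∫ x, ‖ψ x‖ ^ 2) ≤ 1 := (Real.sqrt_le_sqrt hψ1).trans_eq Real.sqrt_one
  have hF0 : 0 ≤ Real.sqrt (∫ x, ‖Torus.convect w v x + Torus.convect v w x -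
      ν • Torus.laplacian v x + Torus.gradient r x - c • Torus.partialDeriv (2 : Fin 3) v x -
      b • φ x‖ ^ 2) := Real.sqrt_nonneg _
  have hb : |b| * |∫ x, ⟪ψ x, φ x⟫_ℝ| =
      |(∫ x, ⟪ψ x, Torus.convect w v x + Torus.convect v w x - ν • Torus.laplacian v x +
        Torus.gradient r x - c • Torus.partialDeriv (2 : Fin 3) v x⟫_ℝ) -
        ∫ x, ⟪ψ x, Torus.convect w v x + Torus.convect v w x - ν • Torus.laplacian v x +
          Torus.gradient r x - c • Torus.partialDeriv (2 : Fin 3) v x - b • φ x⟫_ℝ| := by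
    rw [hsplit, sub_sub_cancel, abs_mul]
  rw [hb]
  refine (abs_sub _ _).trans ?_
  nlinarith [hco, hCS, mul_le_mul_of_nonneg_right hψle hF0]

/-! ## The stub -/

/-- **Keller bordering, analytic half** (stub `stub_kellerAnalysis` of the line `birth` of the
crux `NeutralTaylorWaves.NonresonantSelection`, registered signature verbatim). At a smooth
divergence-free base `w` with drift `c`, viscosity `ν`, let
`A(v, r) = w·∇v + v·∇w − νΔv + ∇r − c∂₃v` and let `(v, r, b)` be a test triple with bordered
residual `F = A(v, r) − b∂₃w`. Put `Φ² = ‖∂₃w‖₂² > 0`, `s = ⟨v, ∂₃w⟩/Φ²` and `u = v − s∂₃w`.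
Then (i) `‖v‖₂ ≤ ‖u‖₂ + |s|Φ`; (ii) under the reduced bound `‖u′‖₂ ≤ Λ‖A(u′, r′)‖₂` on test
fields `u′ ⊥ ∂₃w` (`Λ ≥ 0`) and `‖A(∂₃w, q₃)‖₂ ≤ ρ`: `‖u‖₂ ≤ Λ(‖F‖₂ + |b|Φ + |s|ρ)`;
(iii) under `|⟨ψ, A(v′, r′)⟩| ≤ ρ′‖v′‖₂` on the test class and `‖ψ‖₂ ≤ 1`:
`|b|·|⟨ψ, ∂₃w⟩| ≤ ‖F‖₂ + ρ′‖v‖₂`. [folklore] -/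
theorem stub_kellerAnalysis :
    ∀ (ν c b Λ ρ ρ' : ℝ) (w ψ v : UnitAddTorus (Fin 3) → EuclideanSpace ℝ (Fin 3))
      (q₃ r : UnitAddTorus (Fin 3) → ℝ),
      0 ≤ Λ → Torus.IsSmooth w → Torus.IsDivFree w → Torus.IsSmooth ψ → Torus.IsSmooth q₃ →
      Torus.IsSmooth v → Torus.IsDivFree v → Torus.HasZeroMean v → Torus.IsSmooth r →
      0 < (∫ x, ‖Torus.partialDeriv (2 : Fin 3) w x‖ ^ 2) →
      (∫ x, ‖ψ x‖ ^ 2) ≤ 1 →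
      (∀ (u : UnitAddTorus (Fin 3) → EuclideanSpace ℝ (Fin 3)) (r' : UnitAddTorus (Fin 3) → ℝ),
        Torus.IsSmooth u → Torus.IsSmooth r' → Torus.IsDivFree u → Torus.HasZeroMean u →
        (∫ x, inner ℝ (u x) (Torus.partialDeriv (2 : Fin 3) w x)) = 0 →
        Real.sqrt (∫ x, ‖u x‖ ^ 2) ≤
          Λ * Real.sqrt (∫ x, ‖Torus.convect w u x + Torus.convect u w x - ν • Torus.laplacian u x +
            Torus.gradient r' x - c • Torus.partialDeriv (2 : Fin 3) u x‖ ^ 2)) →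
      Real.sqrt (∫ x, ‖Torus.convect w (Torus.partialDeriv (2 : Fin 3) w) x +
          Torus.convect (Torus.partialDeriv (2 : Fin 3) w) w x -
          ν • Torus.laplacian (Torus.partialDeriv (2 : Fin 3) w) x + Torus.gradient q₃ x -
          c • Torus.partialDeriv (2 : Fin 3) (Torus.partialDeriv (2 : Fin 3) w) x‖ ^ 2) ≤ ρ →
      (∀ (v' : UnitAddTorus (Fin 3) → EuclideanSpace ℝ (Fin 3)) (r' : UnitAddTorus (Fin 3) → ℝ),
        Torus.IsSmooth v' → Torus.IsSmooth r' → Torus.IsDivFree v' → Torus.HasZeroMean v' →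
        |∫ x, inner ℝ (ψ x) (Torus.convect w v' x + Torus.convect v' w x - ν • Torus.laplacian v' x +
            Torus.gradient r' x - c • Torus.partialDeriv (2 : Fin 3) v' x)| ≤
          ρ' * Real.sqrt (∫ x, ‖v' x‖ ^ 2)) →
      Real.sqrt (∫ x, ‖v x‖ ^ 2) ≤
          Real.sqrt (∫ x, ‖v x -
            ((∫ y, inner ℝ (v y) (Torus.partialDeriv (2 : Fin 3) w y)) /
              (∫ y, ‖Torus.partialDeriv (2 : Fin 3) w y‖ ^ 2)) • Torus.partialDeriv (2 : Fin 3) w x‖ ^ 2) +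
          |(∫ y, inner ℝ (v y) (Torus.partialDeriv (2 : Fin 3) w y)) /
              (∫ y, ‖Torus.partialDeriv (2 : Fin 3) w y‖ ^ 2)| *
            Real.sqrt (∫ x, ‖Torus.partialDeriv (2 : Fin 3) w x‖ ^ 2) ∧
        Real.sqrt (∫ x, ‖v x -
            ((∫ y, inner ℝ (v y) (Torus.partialDeriv (2 : Fin 3) w y)) /
              (∫ y, ‖Torus.partialDeriv (2 : Fin 3) w y‖ ^ 2)) • Torus.partialDeriv (2 : Fin 3) w x‖ ^ 2) ≤
          Λ * (Real.sqrt (∫ x, ‖Torus.convect w v x + Torus.convect v w x - ν • Torus.laplacian v x +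
              Torus.gradient r x - c • Torus.partialDeriv (2 : Fin 3) v x -
              b • Torus.partialDeriv (2 : Fin 3) w x‖ ^ 2) +
            |b| * Real.sqrt (∫ x, ‖Torus.partialDeriv (2 : Fin 3) w x‖ ^ 2) +
            |(∫ y, inner ℝ (v y) (Torus.partialDeriv (2 : Fin 3) w y)) /
                (∫ y, ‖Torus.partialDeriv (2 : Fin 3) w y‖ ^ 2)| * ρ) ∧
        |b| * |∫ x, inner ℝ (ψ x) (Torus.partialDeriv (2 : Fin 3) w x)| ≤
          Real.sqrt (∫ x, ‖Torus.convect w v x + Torus.convect v w x - ν • Torus.laplacian v x +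
              Torus.gradient r x - c • Torus.partialDeriv (2 : Fin 3) v x -
              b • Torus.partialDeriv (2 : Fin 3) w x‖ ^ 2) +
            ρ' * Real.sqrt (∫ x, ‖v x‖ ^ 2) := by
  intro ν c b Λ ρ ρ' w ψ v q₃ r hΛ hw hwdiv hψ hq hv hvdiv hvmean hr hI hψ1 hgap hker hcoker
  have hφ : Torus.IsSmooth (Torus.partialDeriv (2 : Fin 3) w) := hw.partialDeriv 2
  exact ⟨nonresonantSelection_keller_sqrt_integral_le_sub_add hv.continuous hφ.continuous _,
    nonresonantSelection_keller_reduced_bound hΛ hw hφ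
      (NonresonantSelection.Negative.isDivFree_partialDeriv hw hwdiv 2)
      (Torus.hasZeroMean_partialDeriv hw 2) hq hv hvdiv hvmean hr
      (nonresonantSelection_keller_orthogonal hv hφ hI.ne') hgap hker,
    nonresonantSelection_keller_border_bound hw hψ hv hr hφ hψ1 (hcoker v r hv hr hvdiv hvmean)⟩

end Summit.AnomalousDissipation.AnomalousDissipation.Theorems

end
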